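import Summits.BirchSwinnertonDyer.Rank1Residual.X4.KimDefectLevelLowering
import Summits.BirchSwinnertonDyer.Rank1Residual.X4.KuriharaLevelLoweringTwistMinus
import HarnessLib

/-!
# The level-lowering certificate over a RESIDUE FIELD `k ⊇ 𝔽_p` (`PlusSymbolLevelLowersOver`): every consequence of V39 survives, and the twist transport lands in `k` (cell `b2b-bsdres`, seat additive-p4 gen 23, line V42)

HONEST FRAMING (verbatim, cell `b2b-bsdres`): the goal of the cell is to DELETE the COMBINATION-SHAPED
residual classes for ALL analytic-rank `≤ 1` curves over `ℚ` — "full BSD formula for every rank `≤ 1`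
curve in class `C`" assembled STRICTLY from published theorems — so that the rank-`≤ 1` remainder
becomes exactly the CONSTRUCTION-SHAPED classes, which are TYPED (missing-input Props), NOT attempted;
this is not "finishing BSD". This file: research-route KERNEL THEOREMS (pure algebra over the tree's
`kuriharaNumber` plus the cell's published-input consumers); no named fact is minted, nothing is
booked, X4 stays CONSTRUCTION-SHAPED.

## Why a residue field (line V42 = the V39 certificate from PUBLISHED inputs on the twist-good locus)

Gen 20's certificate `PlusSymbolLevelLowersAt W p f ℓ` (file `X4/KuriharaLevelLowering.lean`) asks
for a `1`-periodic, Hecke-eigen `μ : ℚ → ℤ/p` with `[r]⁺_f mod p = μ(r) − μ(ℓ r)`. Where the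
certificate is to come from PRINT — Ribet's theorem (the mod-`p` representation of `f` is `ℓ`-old:
there is a level-`N/ℓ` eigenform `g ≡ f (mod 𝔭)`), mod-`p` multiplicity one (Mazur, Ribet 1990
Thm. 5.2 (b), Wiles 1995 Thm. 2.1 — in print when `p ∤ N`) and Ihara's lemma (Ribet 1984) — the
function `μ` is the reduced symbol of `g`, whose Fourier coefficients generate a number field: its
values live in the residue field `k = 𝓞_g/𝔭 ⊇ 𝔽_p`, in general NOT in `𝔽_p`. This file therefore
re-derives EVERY consequence of the certificate for a `k`-valued `μ` along a ring map
`ι : ℤ/p →+* k` into any non-trivial commutative ring (`PlusSymbolLevelLowersOver W p f ι ℓ`):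

* §1 the predicate; `…Over (RingHom.id)` ⟺ `…At` (`plusSymbolLevelLowersOver_id_iff`); functoriality
  in `k` (`PlusSymbolLevelLowersOver.map`);
* §2 **every mod-`p` Kurihara number vanishes** (`kuriharaNumber_eq_zero_of_plusSymbolLevelLowersOver`:
  gen 20's `kuriharaSum_oldform_eq_zero` is stated over ANY commutative ring, and `ι` is injective),
  hence `KuriharaDivisibleAt … n 1`, **`∂^{(∞)} ≥ 1`** (`one_le_kuriharaPartialInfty_of_…Over`) and
  the E67 divisibility at `m = 1`;
* §3 **the twist transport lands in `k`** (`plusSymbolLevelLowersOver_of_twistSum_fn`): the V40/V41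
  transport `V ↦ W = V ⊗ χ` of `X4/KuriharaLevelLoweringTwistMinus.lean` with a `k`-valued `V`-side
  old shape `φ = μ − w·μ∘[ℓ]` — this is the form in which the published inputs (which live on the
  twist `V`, conductor `N_V` with `p ∤ N_V` on the twist-good locus `e_p(W) = 2`) reach the additive
  curve `W`;
* §4 the cell's consumers re-keyed to the `k`-valued certificate: **`BSD(E,p)` on unit rows with
  `ord_p ∏_v c_v ≤ 2` at `p ≥ 5`** (Kim 2026 Thm. 1.8 (6) + Cassels–Tate + GZK + modularity, all
  PUBLISHED, + the certificate), its optimal-datum form, the `p ≥ 3` tower twin CONDITIONAL on the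
  announced Kim 2025 clause, and the class-free instrument scope `¬ KuriharaUnitAt`.

Nothing here asserts that a certificate exists: the companion `X4/KuriharaLevelLoweringOfMultiplicityOne.lean`
reduces its existence to two displayed hypotheses in modular-symbol currency (multiplicity one;
a non-zero `ℓ`-old eigensymbol), which are theorems in print exactly when `p ∤ N` — the
sub-partition of the TAM-DEFECT₂ residue recorded in the seat's memo `V42-LEVEL-LOWERING-FROM-PRINT.md`.

## References

* K. A. Ribet, Invent. Math. 100 (1990) 431–476, Thm. 1.1, Thm. 5.2 (b). [cite: Ribet1990, Thm. 1.1 and Thm. 5.2 (b)]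
* A. Wiles, Ann. of Math. 141 (1995), Thm. 2.1. [cite: Wiles1995, Thm. 2.1]
* B. Mazur, J. Tate, J. Teitelbaum, Invent. Math. 84 (1986), §I.4 (4.2), §I.8. [cite: MazurTateTeitelbaum1986Invent, §I.4 (4.2) and §I.8]
* C.-H. Kim, Amer. J. Math. 148 (2026), §1.2.2, §1.4.3, §1.5.1, Thm. 1.9 (6), Conj. 1.10. [cite: Kim2022StructureSelmer, §1.4.3, §1.5.1 and Conj. 1.10]
* B. Mazur, K. Rubin, Mem. AMS 799 (2004), Prop. 6.2.6. [cite: MazurRubin2004, Prop. 6.2.6]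
-/

noncomputable section

open scoped MatrixGroups ModularForm

open CongruenceSubgroup Finset

open Literature.NumberTheory.EllipticCurves Literature.NumberTheory.EllipticCurves.ModularForms

namespace Summit.BirchSwinnertonDyer.Rank1Residual.LevelLowering

variable {k : Type*} [CommRing k]

/-! ### §1 The certificate with values in a ring `k` over `ℤ/p` -/

section Certificate

variable (W : WeierstrassCurve ℚ) [W.IsGloballyMinimal] (p : ℕ) {N : ℕ} (f : CuspForm (Gamma0 N) 2)

/-- **LEVEL-LOWERING CERTIFICATE over a ring `k ⊇ ℤ/p`** (along `ι : ℤ/p →+* k`): a `1`-periodic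
`μ : ℚ → k`, `T_q`-eigen with eigenvalue `ι(a_q(E) mod p)` at every Kolyvagin prime `q` of `(E, p)`,
whose `ℓ`-old difference is the mod-`p` plus symbol of `f` read in `k`:
`ι([r]⁺_f mod p) = μ(r) − μ(ℓ r)` for every `r ∈ ℚ`. For `k = ℤ/p`, `ι = id` this is gen 20's
`PlusSymbolLevelLowersAt` (`plusSymbolLevelLowersOver_id_iff`). WHERE IT COMES FROM (not asserted
here): the reduced, canonically normalised plus symbol `μ` of a level-`N/ℓ` eigenform `g ≡ f (mod 𝔭)`
(Ribet), with values in `k = 𝓞_g/𝔭`, compared with `f`'s symbol by mod-`p` multiplicity one and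
Ihara's lemma (in print for `p ∤ N`). A predicate; nothing asserted.
[cite: Kim2022StructureSelmer, §1.2.2 and §1.4.3 (PDF pp. 5, 7)] [cite: Ribet1990, Thm. 1.1 and Thm. 5.2 (b)] -/
def PlusSymbolLevelLowersOver [Fact p.Prime] (ι : ZMod p →+* k) (ℓ : ℕ) : Prop :=
  ∃ μ : ℚ → k, IsPeriodic μ ∧
    (∀ q : ℕ, Kato.IsKolyvaginPrime W p 1 q → HeckeRel μ q (ι (W.frobeniusTrace q : ZMod p))) ∧
    ∀ r : ℚ, ι ((ratPlusSymbol f r : ℚ) : ZMod p) = μ r - μ (ℓ * r)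

variable {W p f}

/-- Gen 20's `ℤ/p`-valued certificate is the `k = ℤ/p`, `ι = id` case. [cite: Kim2022StructureSelmer, §1.2.2 and §1.4.3 (PDF pp. 5, 7)] -/
theorem plusSymbolLevelLowersOver_id_iff [Fact p.Prime] {ℓ : ℕ} :
    PlusSymbolLevelLowersOver W p f (RingHom.id (ZMod p)) ℓ ↔ PlusSymbolLevelLowersAt W p f ℓ := by
  simp only [PlusSymbolLevelLowersOver, PlusSymbolLevelLowersAt, RingHom.id_apply]

/-- A `ℤ/p`-valued certificate gives a `k`-valued one along any `ι : ℤ/p →+* k`.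
[cite: Kim2022StructureSelmer, §1.2.2 and §1.4.3 (PDF pp. 5, 7)] -/
theorem plusSymbolLevelLowersOver_of_plusSymbolLevelLowersAt [Fact p.Prime] (ι : ZMod p →+* k) {ℓ : ℕ}
    (h : PlusSymbolLevelLowersAt W p f ℓ) : PlusSymbolLevelLowersOver W p f ι ℓ := by
  obtain ⟨μ, hμ, hH, hsym⟩ := h
  refine ⟨fun r ↦ ι (μ r), fun r z ↦ by simp only [hμ r z], fun q hq r ↦ ?_, fun r ↦ ?_⟩
  · have h := congrArg ι (hH q hq r)
    simpa only [map_add, map_sum, map_mul] using h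
  · simp only [hsym r, map_sub]

/-- **Functoriality in the coefficient ring**: a certificate over `k` pushes forward along any ring
map `g : k →+* k'` (e.g. into a bigger residue field). [folklore] -/
theorem PlusSymbolLevelLowersOver.map [Fact p.Prime] {k' : Type*} [CommRing k'] {ι : ZMod p →+* k}
    {ℓ : ℕ} (h : PlusSymbolLevelLowersOver W p f ι ℓ) (g : k →+* k') :
    PlusSymbolLevelLowersOver W p f (g.comp ι) ℓ := by
  obtain ⟨μ, hμ, hH, hsym⟩ := h
  refine ⟨fun r ↦ g (μ r), fun r z ↦ by simp only [hμ r z], fun q hq r ↦ ?_, fun r ↦ ?_⟩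
  · have h := congrArg g (hH q hq r)
    simpa only [map_add, map_sum, map_mul, RingHom.comp_apply] using h
  · simp only [RingHom.comp_apply, hsym r, map_sub]

end Certificate

/-! ### §2 Every mod-`p` Kurihara number vanishes under a `k`-valued certificate; `∂^{(∞)} ≥ 1` -/

section Vanishing

variable {W : WeierstrassCurve ℚ} [W.IsGloballyMinimal] {p : ℕ} {N : ℕ} {f : CuspForm (Gamma0 N) 2}

/-- **EVERY mod-`p` Kurihara number vanishes under a `k`-valued certificate** (`k` non-trivial, so
that `ι : ℤ/p →+* k` is injective): `kuriharaNumber f p n ψ = 0` for every `n ∈ 𝒩_1(E, p)` and every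
choice of discrete logarithms `ψ`. Proof: apply `ι`; the image is the Kurihara sum, over `k`, of the
`ℓ`-old difference `μ − μ∘[ℓ]` against the pushed-forward characters, which vanishes by gen 20's
`kuriharaSum_oldform_eq_zero` (stated over any commutative ring).
[cite: Kim2022StructureSelmer, §1.2.2 and §1.4.3 (PDF pp. 5, 7)] -/
theorem kuriharaNumber_eq_zero_of_plusSymbolLevelLowersOver [Fact p.Prime] [Nontrivial k]
    {ι : ZMod p →+* k} {ℓ : ℕ} (hcert : PlusSymbolLevelLowersOver W p f ι ℓ)
    (hℓ : ℓ ∣ W.conductorNorm ℤ) {n : ℕ} [NeZero n] (hn : Kato.IsKolyvaginProduct W p 1 n)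
    (ψ : (q : ℕ) → (ZMod q)ˣ →* Multiplicative (ZMod p)) : kuriharaNumber f p n ψ = 0 := by
  obtain ⟨μ, hμ, hH, hsym⟩ := hcert
  apply ι.injective
  rw [map_zero, kuriharaNumber_eq_sum_ratCast, map_sum]
  have hP : ∀ q, Kato.IsKolyvaginPrime W p 1 q → q.Prime ∧ HeckeRel μ q 2 := fun q hq ↦ by
    refine ⟨hq.prime, ?_⟩
    have h := hH q hq
    rwa [(Kato.isKolyvaginPrime_one_iff.mp hq).2.2.2, map_ofNat] at h
  have hcop : ℓ.Coprime n := Nat.coprime_of_dvd fun q hq hqℓ hqn ↦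
    (hn.2 q (Nat.mem_primeFactors.mpr ⟨hq, hqn, NeZero.ne n⟩)).not_dvd_conductorNorm
      (dvd_trans hqℓ hℓ)
  -- the characters `ψ_q : (ℤ/q)ˣ → ℤ/p` read in `k` along `ι`
  have h0 := kuriharaSum_oldform_eq_zero
    (fun q ↦ (AddMonoidHom.toMultiplicative ι.toAddMonoidHom).comp (ψ q)) hμ hP n hn.squarefree
    hn.2 hcop
  rw [← h0]
  refine Finset.sum_congr rfl fun a _ ↦ ?_
  rw [map_mul, hsym, map_prod, ← prod_attach_toAdd_eq_weight]
  rfl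

variable (W p) in
/-- **`δ̃_n ∈ p ℤ_p/I_nℤ_p` at every level** (`KuriharaDivisibleAt … n 1`) for the newform `D.f` of an
elliptic curve with `E[p]` irreducible, `p` odd, conductor `= N`, under a `k`-valued certificate
(the gen-20 proof with §2's vanishing theorem as its first step).
[cite: Kim2022StructureSelmer, §1.4.3 and §1.5.1 (PDF p. 7)] -/
theorem kuriharaDivisibleAt_one_of_plusSymbolLevelLowersOver [W.IsElliptic] [Fact p.Prime]
    [Nontrivial k] (hp2 : p ≠ 2) (hirr : W.HasIrreducibleModPGaloisRep p) [NeZero N]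
    (D : ModularParametrizationData W N) (hN : W.conductorNorm ℤ = N) {ι : ZMod p →+* k} {ℓ : ℕ}
    (hcert : PlusSymbolLevelLowersOver W p D.f ι ℓ) (hℓ : ℓ ∣ W.conductorNorm ℤ)
    (n : ℕ) : KuriharaDivisibleAt W p D.f n 1 := by
  intro j hj hjn ψ _
  interval_cases j
  · haveI : Subsingleton (ZMod (p ^ 0)) := ZMod.subsingleton_iff.mpr (pow_zero p)
    exact Subsingleton.elim _ _
  · haveI : NeZero n := ⟨hjn.ne_zero⟩
    haveI : NeZero (p ^ 1) := ⟨pow_ne_zero 1 (Fact.out : p.Prime).ne_zero⟩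
    have hdvd : p ∣ p ^ 1 := dvd_pow_self p one_ne_zero
    have hcopN : n.Coprime N := by
      have := hjn.coprime
      rw [hN] at this
      exact Nat.Coprime.coprime_dvd_right (dvd_mul_right N p) this
    have hden : ∀ a : ℕ, (ratPlusSymbol D.f ((a : ℚ) / n)).den.Coprime (p ^ 1) := by
      intro a
      have hnd := D.isNewformOf.not_dvd_den_ratPlusSymbol_div hp2 hirr hcopN (a : ℤ)
      rw [Int.cast_natCast] at hnd
      exact Nat.Coprime.pow_right 1
        (Nat.coprime_comm.mp ((Nat.Prime.coprime_iff_not_dvd Fact.out).mpr hnd))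
    have h0 : kuriharaNumber D.f p n (Kim2026.reduceLog hdvd ψ) = 0 :=
      kuriharaNumber_eq_zero_of_plusSymbolLevelLowersOver hcert hℓ hjn _
    rw [← Kim2026.castHom_kuriharaNumber D.f hdvd n ψ hden,
      ← ZMod.natCast_zmod_val (kuriharaNumber D.f (p ^ 1) n ψ), map_natCast,
      ZMod.natCast_eq_zero_iff] at h0
    rw [← ZMod.natCast_zmod_val (kuriharaNumber D.f (p ^ 1) n ψ), ZMod.natCast_eq_zero_iff]
    exact (dvd_of_eq (pow_one p)).trans h0

variable (W p) in
/-- **`∂^{(∞)}(δ̃) ≥ 1` under a `k`-valued certificate** (the tree's `kuriharaPartialInfty`, cyclic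
levels) — the `α = 1` input of the ONE-FACTOR SOCKET (`X4/KimDefectParity.lean`), now reachable from a
certificate produced over a residue field `k ⊋ 𝔽_p`.
[cite: Kim2022StructureSelmer, §1.5.1 (PDF p. 7) and Conj. 1.10 (PDF p. 8)] -/
theorem one_le_kuriharaPartialInfty_of_plusSymbolLevelLowersOver [W.IsElliptic] [Fact p.Prime]
    [Nontrivial k] (hp2 : p ≠ 2) (hirr : W.HasIrreducibleModPGaloisRep p) [NeZero N]
    (D : ModularParametrizationData W N) (hN : W.conductorNorm ℤ = N) {ι : ZMod p →+* k} {ℓ : ℕ}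
    (hcert : PlusSymbolLevelLowersOver W p D.f ι ℓ) (hℓ : ℓ ∣ W.conductorNorm ℤ) :
    (1 : ℕ∞) ≤ kuriharaPartialInfty W p D.f := by
  refine le_iInf fun i ↦ ?_
  rw [kuriharaPartial_def]
  refine le_iInf fun n ↦ le_iInf fun _ ↦ le_iInf fun _ ↦ ?_
  exact_mod_cast le_kuriharaDivIndex_of_divisibleAt W p D.f
    (kuriharaDivisibleAt_one_of_plusSymbolLevelLowersOver W p hp2 hirr D hN hcert hℓ n)

variable (W p) in
/-- **The E67 hypothesis at `m = 1`** (`p^{min(1,k')} ∣ δ̃_n^{(k')}` for every `k'`, every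
`n ∈ 𝒩_{k'}` and every surjective `ψ`) under a `k`-valued certificate.
[cite: Kim2022StructureSelmer, Thm. 1.9 (6) (PDF p. 8), §1.5.1 (PDF p. 7)] -/
theorem pow_min_one_dvd_kuriharaNumber_of_plusSymbolLevelLowersOver [W.IsElliptic] [Fact p.Prime]
    [Nontrivial k] (hp2 : p ≠ 2) (hirr : W.HasIrreducibleModPGaloisRep p) [NeZero N]
    (D : ModularParametrizationData W N) (hN : W.conductorNorm ℤ = N) {ι : ZMod p →+* k} {ℓ : ℕ}
    (hcert : PlusSymbolLevelLowersOver W p D.f ι ℓ) (hℓ : ℓ ∣ W.conductorNorm ℤ)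
    {k' : ℕ} {n : ℕ} [NeZero n] (hn : Kato.IsKolyvaginProduct W p k' n)
    (ψ : (q : ℕ) → (ZMod q)ˣ →* Multiplicative (ZMod (p ^ k')))
    (hψ : ∀ q ∈ n.primeFactors, Function.Surjective (ψ q)) :
    ((p ^ min 1 k' : ℕ) : ZMod (p ^ k')) ∣ kuriharaNumber D.f (p ^ k') n ψ :=
  Kim2026.pow_min_dvd_kuriharaNumber_of_kuriharaDivisibleAt W p hp2 hirr D hN hn
    (kuriharaDivisibleAt_one_of_plusSymbolLevelLowersOver W p hp2 hirr D hN hcert hℓ n) ψ hψ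

end Vanishing

/-! ### §3 The twist transport lands in `k` -/

section TransportOver

variable (W : WeierstrassCurve ℚ) [W.IsGloballyMinimal] (p : ℕ) [Fact p.Prime] (ι : ZMod p →+* k)
  {m : ℕ} [NeZero m] (χ : ZMod m →* k) {NW : ℕ} (fW : CuspForm (Gamma0 NW) 2)

/-- A Hecke relation survives multiplication of the function by a constant. [folklore] -/
private theorem heckeRel_const_mul_over {R : Type*} [CommRing R] {ν : ℚ → R} {q : ℕ} {a : R}
    (h : HeckeRel ν q a) (c : R) : HeckeRel (fun r ↦ c * ν r) q a := by
  intro r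
  have := congrArg (fun x ↦ c * x) (h r)
  simp only [mul_add, Finset.mul_sum] at this
  simp only
  rw [this]
  ring

/-- **TRANSPORT OF THE CERTIFICATE FROM A `k`-VALUED `V`-SIDE OLD SHAPE** (the V40/V41 transport of
`X4/KuriharaLevelLoweringTwistMinus.lean`, verbatim over `k`). If the mod-`p` plus symbol of `f_W`,
read in `k`, is `c` times the `χ`-twisted sum of a function `φ : ℚ → k` (`hsym`; `χ : ℤ/m → k` a
quadratic character, e.g. `ι ∘ (·/p)` or `ι ∘ (·/|D|)`), `φ = μ − w·μ∘[ℓ]` is `ℓ`-old with `μ`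
periodic and `T_q`-eigen (eigenvalue `e_q`, `χ(q) e_q = ι(a_q(W))`, `q` invertible mod `m`,
`χ(q)² = 1`) at the Kolyvagin primes of `(W, p)`, `ℓ` invertible mod `m`, `χ(ℓ)² = 1`, `w·χ(ℓ) = 1`,
then `PlusSymbolLevelLowersOver W p f_W ι ℓ` (witness `c·T_χ μ`). This is the form in which a
published `V`-side level-lowering (`μ` = reduced symbol of Ribet's `g`, values in `k = 𝓞_g/𝔭`) reaches
the additive curve `W = V ⊗ χ`. [cite: Kim2022StructureSelmer, §1.2.2 and §1.4.3]
[cite: MazurTateTeitelbaum1986Invent, §I.4 (4.2) and §I.8] -/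
theorem plusSymbolLevelLowersOver_of_twistSum_fn (c : k) (φ : ℚ → k)
    (hsym : ∀ r : ℚ, ι ((ratPlusSymbol fW r : ℚ) : ZMod p) =
      c * ∑ u : ZMod m, χ u * φ (r + (u.val : ℚ) / m))
    {μ : ℚ → k} (hμ : IsPeriodic μ) {w : k} {ℓ : ℕ}
    (hV : ∀ r : ℚ, φ r = μ r - w * μ (ℓ * r))
    (hℓ : IsUnit ((ℓ : ℕ) : ZMod m)) (hχℓ : χ ℓ ^ 2 = 1) (hw : w * χ ℓ = 1)
    (e : ℕ → k)
    (hH : ∀ q : ℕ, Kato.IsKolyvaginPrime W p 1 q →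
      HeckeRel μ q (e q) ∧ IsUnit ((q : ℕ) : ZMod m) ∧ χ q ^ 2 = 1 ∧
        χ q * e q = ι (W.frobeniusTrace q : ZMod p)) :
    PlusSymbolLevelLowersOver W p fW ι ℓ := by
  refine ⟨fun r ↦ c * ∑ u : ZMod m, χ u * μ (r + (u.val : ℚ) / m), ?_, ?_, ?_⟩
  · intro r z
    have hper := isPeriodic_twistSum χ hμ r z
    simp only at hper ⊢
    rw [hper]
  · intro q hq
    obtain ⟨hHq, hqu, hχq, haq⟩ := hH q hq
    rw [← haq]
    exact heckeRel_const_mul_over (heckeRel_twistSum χ hμ hq.prime.ne_zero hqu hχq hHq) c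
  · intro r
    rw [hsym r, twistSum_oldform χ hμ hℓ hχℓ hV r, hw, one_mul, mul_sub]

end TransportOver

end Summit.BirchSwinnertonDyer.Rank1Residual.LevelLowering

/-! ### §4 Consumers: the TAM-DEFECT₂ closures re-keyed to a `k`-valued certificate -/

namespace Summit.BirchSwinnertonDyer.Rank1Residual.X4

open Complex WeierstrassCurve Literature.NumberTheory.EllipticCurves.Rank1Residual
  Literature.NumberTheory.EllipticCurves.Rank1Residual.Typed
  Summit.BirchSwinnertonDyer.Rank1Residual.LevelLowering

variable {k : Type*} [CommRing k] [Nontrivial k]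
  (W : WeierstrassCurve ℚ) [W.IsElliptic] [W.IsGloballyMinimal] (p : ℕ) [Fact p.Prime]

/-- **THE TAM-DEFECT₂ CLOSURE at `p ≥ 5` from a `k`-VALUED certificate.** For `W/ℚ` globally minimal
of analytic rank `0`, `p ≥ 5` with `ρ̄_{E,p}` onto (ANY reduction at `p`, additive included), a
conductor-level datum `D` with `p ∤ c_D` and the period transfer, `#Ш_an(E) = q'` a `p`-adic unit,
`ord_p ∏_v c_v ≤ 2`, and a level-lowering certificate OVER ANY NON-TRIVIAL RING `k ⊇ ℤ/p` for the plus
symbol of `D.f` at some `ℓ ∣ N_E`: **`BSD(E,p)` holds.** Inputs: Kim 2026 Thm. 1.8 (6) (`hKimk`,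
`hE67c`), Cassels–Tate (`hCT`), GZK, modularity — all PUBLISHED — and the certificate. On the twist-good
locus (`e_p(E) = 2`, twist `V` good at `p`) the certificate is Ribet + multiplicity one + Ihara on `V`
(in print, `p ∤ N_V`) transported by §3; elsewhere it is per-pair EVIDENCE. Nothing booked; X4
CONSTRUCTION-SHAPED. [cite: Kim2022StructureSelmer, Thm. 1.9 (6) and Conj. 1.10 (PDF p. 8)]
[cite: SilvermanAEC2009, Thm. X.4.14] [cite: Miller2011LMS, §1 and Def. 1.1] -/
theorem bsdp_of_plusSymbolLevelLowersOver_of_tamagawa_le_two_of_shaAn_unit_of_five_le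
    (hKimk : Kim2026.rankZero_le_padicValNat_sha_of_kuriharaNumber_ne_zero)
    (hE67c : Kim2026.rankZero_padicValNat_sha_add_le_of_forall_pow_dvd_kuriharaNumber_cyclicLevel)
    (hCT : exists_casselsTate_pairing (K := ℚ))
    (hGZK : rank_eq_analyticRank_of_analyticRank_le_one) (hmod : hasEntireLFunction_rat)
    (hp : 5 ≤ p) (hr : W.analyticRank = 0) (hsurj : W.HasSurjectiveModNGaloisRep p)
    {N : ℕ} [NeZero N] (D : ModularParametrizationData W N) (hN : W.conductorNorm ℤ = N)
    (hc : ¬ (p : ℤ) ∣ D.maninConstant)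
    (hper : ∃ u : ℚ, ‖(u : ℚ_[p])‖ = 1 ∧ W.realPeriodRat = u * plusPeriod D.f)
    {q' : ℚ} (hq' : shaAn W = (q' : ℂ)) (hv : padicValRat p q' = 0)
    {ι : ZMod p →+* k} {ℓ : ℕ} (hcert : PlusSymbolLevelLowersOver W p D.f ι ℓ)
    (hℓ : ℓ ∣ W.conductorNorm ℤ) (hc2 : padicValNat p W.tamagawaProduct ≤ 2) : BSDp W p := by
  have hirr := hasIrreducibleModPGaloisRep_of_hasSurjectiveModNGaloisRep W p hsurj
  have h1 : (1 : ℕ∞) ≤ kuriharaPartialInfty W p D.f :=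
    one_le_kuriharaPartialInfty_of_plusSymbolLevelLowersOver W p (by omega) hirr D hN hcert hℓ
  exact bsdp_of_le_kimDefect_of_tamagawa_le_add_one_of_shaAn_unit W p hKimk hE67c hCT hGZK hmod hp hr
    hsurj D hN hc hper hq' hv (α := 1) (by exact_mod_cast h1) (by omega)

/-- **The `p ≥ 5` closure on an OPTIMAL conductor-level datum** (period transfer by optimality), from a
`k`-valued certificate — the census shape. [cite: Kim2022StructureSelmer, Thm. 1.9 (6) and Conj. 1.10 (PDF p. 8)]
[cite: SilvermanAEC2009, Thm. X.4.14] [cite: Miller2011LMS, §1 and Def. 1.1] [cite: CremonaAlgorithms1997, §2.8 (p. 26)] -/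
theorem bsdp_of_plusSymbolLevelLowersOver_of_tamagawa_le_two_of_shaAn_unit_of_optimal_of_five_le
    (hKimk : Kim2026.rankZero_le_padicValNat_sha_of_kuriharaNumber_ne_zero)
    (hE67c : Kim2026.rankZero_padicValNat_sha_add_le_of_forall_pow_dvd_kuriharaNumber_cyclicLevel)
    (hCT : exists_casselsTate_pairing (K := ℚ))
    (hGZK : rank_eq_analyticRank_of_analyticRank_le_one) (hmod : hasEntireLFunction_rat)
    (hp : 5 ≤ p) (hr : W.analyticRank = 0) (hsurj : W.HasSurjectiveModNGaloisRep p)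
    {N : ℕ} [NeZero N] (D : ModularParametrizationData W N) (hN : W.conductorNorm ℤ = N)
    (hopt : ∀ z ∈ D.L.lattice, ∃ w ∈ periodLattice D.f, z = D.c * w)
    (hc : ¬ (p : ℤ) ∣ D.maninConstant)
    {q' : ℚ} (hq' : shaAn W = (q' : ℂ)) (hv : padicValRat p q' = 0)
    {ι : ZMod p →+* k} {ℓ : ℕ} (hcert : PlusSymbolLevelLowersOver W p D.f ι ℓ)
    (hℓ : ℓ ∣ W.conductorNorm ℤ) (hc2 : padicValNat p W.tamagawaProduct ≤ 2) : BSDp W p :=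
  bsdp_of_plusSymbolLevelLowersOver_of_tamagawa_le_two_of_shaAn_unit_of_five_le W p hKimk hE67c hCT hGZK
    hmod hp hr hsurj D hN hc (periodTransfer_of_optimal p D hopt hc) hq' hv hcert hℓ hc2

/-- **The `p ≥ 3` tower twin, CONDITIONAL on the announced Kim 2025 clause** (`hK25s`, flag
`Kim2025-preprint`): analytic rank `0`, `ρ̄_{E,p^n}` onto for all `n`, conductor-level datum with the
period transfer, `#Ш_an` a `p`-unit, `ord_p ∏_v c_v ≤ 2`, and a `k`-valued level-lowering certificate
at some `ℓ ∣ N_E` ⟹ `BSD(E,p)`. At `p = 3` this is the N11 TAM-DEFECT₂(3) block; on its twist-good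
part (`V = E^{(−3)}` good at `3`, `3 ∤ N_V`) the certificate is Ribet + multiplicity one + Ihara on
`V` in print. [claim: Kim2025RefinedTNC, status: under-review]
[cite: Kim2025RefinedTNC, Thm. 1.1 ("BSD") (ANNOUNCED, OPEN binder)] [cite: SilvermanAEC2009, Thm. X.4.14]
[cite: Kim2022StructureSelmer, Conj. 1.10 (PDF p. 8)] [cite: Miller2011LMS, §1 and Def. 1.1] -/
theorem bsdp_of_plusSymbolLevelLowersOver_of_tamagawa_le_two_of_shaAn_unit_of_kim2025_OPEN
    (hK25s : Kim2025.thm11_kimShaLength_of_integralPeriod_OPEN)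
    (hCT : exists_casselsTate_pairing (K := ℚ))
    (hGZK : rank_eq_analyticRank_of_analyticRank_le_one) (hmod : hasEntireLFunction_rat)
    (hp3 : 3 ≤ p) (hr : W.analyticRank = 0) (htower : ∀ n : ℕ, W.HasSurjectiveModNGaloisRep (p ^ n : ℕ))
    {N : ℕ} [NeZero N] (D : ModularParametrizationData W N) (hN : W.conductorNorm ℤ = N)
    (hper : ∃ u : ℚ, ‖(u : ℚ_[p])‖ = 1 ∧ W.realPeriodRat = u * plusPeriod D.f)
    {q' : ℚ} (hq' : shaAn W = (q' : ℂ)) (hv : padicValRat p q' = 0)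
    {ι : ZMod p →+* k} {ℓ : ℕ} (hcert : PlusSymbolLevelLowersOver W p D.f ι ℓ)
    (hℓ : ℓ ∣ W.conductorNorm ℤ) (hc2 : padicValNat p W.tamagawaProduct ≤ 2) : BSDp W p := by
  have hsurj : W.HasSurjectiveModNGaloisRep p := by simpa using htower 1
  have hirr := hasIrreducibleModPGaloisRep_of_hasSurjectiveModNGaloisRep W p hsurj
  have h1 : (1 : ℕ∞) ≤ kuriharaPartialInfty W p D.f :=
    one_le_kuriharaPartialInfty_of_plusSymbolLevelLowersOver W p (by omega) hirr D hN hcert hℓ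
  exact Additive.bsdp_of_le_kimDefect_of_tamagawa_le_add_one_of_shaAn_unit_of_kim2025_OPEN W p hK25s
    hCT hGZK hmod hp3 hr htower D hper hq' hv (α := 1) (by exact_mod_cast h1) (by omega)

/-- **Instrument scope (class-free): under a `k`-valued certificate NO cyclic-level Kurihara number is
a `p`-adic unit** (`¬ KuriharaUnitAt W p D.f`; `p` odd, `E[p]` irreducible, conductor-level datum):
`∂^{(∞)} ≥ 1 ≠ 0`. [cite: MazurRubin2004, Prop. 6.2.6]
[cite: Kim2022StructureSelmer, §1.5.1 (PDF p. 7) and Rem. 6.2 (PDF p. 31)] -/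
theorem not_kuriharaUnitAt_of_plusSymbolLevelLowersOver (hp2 : p ≠ 2)
    (hirr : W.HasIrreducibleModPGaloisRep p)
    {N : ℕ} [NeZero N] (D : ModularParametrizationData W N) (hN : W.conductorNorm ℤ = N)
    {ι : ZMod p →+* k} {ℓ : ℕ} (hcert : PlusSymbolLevelLowersOver W p D.f ι ℓ)
    (hℓ : ℓ ∣ W.conductorNorm ℤ) : ¬ KuriharaUnitAt W p D.f := by
  rw [kuriharaUnitAt_iff_kuriharaPartialInfty_eq_zero]
  intro h0
  have h1 := one_le_kuriharaPartialInfty_of_plusSymbolLevelLowersOver W p hp2 hirr D hN hcert hℓ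
  rw [h0] at h1
  exact absurd h1 (by norm_num)

end Summit.BirchSwinnertonDyer.Rank1Residual.X4

end
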